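import Mathlib
import Literature.Geometry.Lorentzian.KerrSchild
import Summits.FinalStateConjecture.FinalStateConjecture.Theses.PhaseMixingCapture

/-!
# Sketch (crux-ideate round 2, ideator 4) — crux `BulkKerrCaptureC2` (stmt-FinalStateConjecture-14985)

First-lemma sheet for the crux idea `killing-span-twist` (NOT a skeleton: no `stub_*`, no
`BulkKerrCaptureC2_of`). Everything is stated over existing declarations of
`Literature/Geometry/Lorentzian/KerrSchild.lean` (ingoing Kerr–Schild Cartesian coordinates on
`E4`: `Kerr.radius`, `Kerr.nullCovector` = the principal null covector `ℓ`, `Kerr.bilin` = the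
Kerr metric `η + 2Hℓ⊗ℓ`, `Kerr.stationaryField = ∂_{t*}`, `Kerr.axialField = x₁∂₂ − x₂∂₁`)
and Mathlib.

The lever's geometric input, in tree language: the *Hawking vector field*
`T̂ = ∂_{t*} + (a/(r² + a²)) ∂_φ` — a `C^∞(r)`-combination of the two Killing fields — is
`g`-orthogonal to the principal horizontal distribution `ℋ = ker ℓ ∩ ker dr`, i.e. it lies in the
principal null 2-plane `Π = span{ℓ♯, ∇r} = span{e₃, e₄}`; since `ker dr` is integrable and
`ℋ ⊂ ker dr` has codimension one in it, the non-integrability (twist) of `ℋ` is `T̂`-valued: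
`[ℋ, ℋ] ⊂ ℋ ⊕ ℝ T̂`.

F1′ and F1 are PROVED below (sorry-free); F2, F4 are stated as `Prop`s; F3 is `rfl`.
-/

open Literature.Geometry.Lorentzian

noncomputable section

-- the doubled `FinalStateConjecture.FinalStateConjecture` path component trips dupNamespace
set_option linter.dupNamespace false

namespace Summit.FinalStateConjecture.FinalStateConjecture.Cruxes.BulkKerrCaptureC2.Ideator4

/-- The **Hawking vector field** `T̂(x) = ∂_{t*} + (a / (r² + a²)) (x₁ ∂₂ − x₂ ∂₁)` at a point
of the Kerr–Schild chart (Giorgi–Klainerman–Szeftel 2022, Prop. 3.2.2: causal everywhere on the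
exterior, null only on the horizon; NOT Killing, but in the `C^∞(r)`-span of the Killing fields
`∂_{t*}`, `∂_φ`). -/
def hawkingVector (a : ℝ) (x : E4) : E4 :=
  E4.basisVector 0 +
    (a / (Kerr.radius a x ^ 2 + a ^ 2)) • ((x 1) • E4.basisVector 2 - (x 2) • E4.basisVector 1)

/-- The **radial covector** `ν = r² (x₁ dx₁ + x₂ dx₂) + (r² + a²) x₃ dx₃`, a positive multiple of
`dr` off the ring (implicit differentiation of `r⁴ − (ρ² − a²) r² − a² x₃² = 0`). -/
def radialCovector (a : ℝ) (x : E4) : E4 →L[ℝ] ℝ :=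
  E4.covector ![0, Kerr.radius a x ^ 2 * x 1, Kerr.radius a x ^ 2 * x 2,
    (Kerr.radius a x ^ 2 + a ^ 2) * x 3]

theorem hawkingVector_apply_zero (a : ℝ) (x : E4) : hawkingVector a x 0 = 1 := by
  simp [hawkingVector]

theorem hawkingVector_apply_one (a : ℝ) (x : E4) :
    hawkingVector a x 1 = -(a / (Kerr.radius a x ^ 2 + a ^ 2)) * x 2 := by
  simp [hawkingVector]

theorem hawkingVector_apply_two (a : ℝ) (x : E4) :
    hawkingVector a x 2 = (a / (Kerr.radius a x ^ 2 + a ^ 2)) * x 1 := by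
  simp [hawkingVector]

theorem hawkingVector_apply_three (a : ℝ) (x : E4) : hawkingVector a x 3 = 0 := by
  simp [hawkingVector]

/-- **F1′ (the identity behind F1), PROVED.** `η(T̂, ·) = −ℓ + ν / (r (r² + a²))`: the `η`-flat
of the Hawking field is an explicit combination of the principal null covector and the radial
covector. A rational identity in `(r, a, x₁, x₂, x₃)`; the quartic defining `r` is not needed. -/
theorem hawkingCovectorIdentity (a : ℝ) (x : E4) (hr : 0 < Kerr.radius a x) (v : E4) :
    Minkowski.bilin (hawkingVector a x) v =
      -Kerr.nullCovector a x v + (Kerr.radius a x * (Kerr.radius a x ^ 2 + a ^ 2))⁻¹ *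
        radialCovector a x v := by
  have h1 : Kerr.radius a x ≠ 0 := hr.ne'
  have h2 : Kerr.radius a x ^ 2 + a ^ 2 ≠ 0 := by positivity
  rw [Minkowski.bilin_apply]
  simp only [Fin.sum_univ_three, hawkingVector_apply_zero, radialCovector, Kerr.nullCovector,
    Kerr.nullCovectorFun, E4.covector_apply, Fin.sum_univ_four]
  simp only [Fin.isValue, Fin.succ_zero_eq_one, Fin.succ_one_eq_two, Matrix.cons_val_zero,
    Matrix.cons_val_one, Matrix.cons_val]
  rw [hawkingVector_apply_one, hawkingVector_apply_two]
  have h3 : (2 : Fin 3).succ = (3 : Fin 4) := rfl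
  simp only [h3, hawkingVector_apply_three]
  field_simp
  ring

/-- **F1 (first lemma of the line), PROVED. The Hawking field is vertical for the principal
horizontal structure**: for every point with `r > 0` and every vector `v` with `ℓ(v) = 0` and
`ν(v) = 0` (`ν ∝ dr`, F2; so `v ∈ ℋ = {e₃, e₄}^⊥`), `g_{M,a}(T̂, v) = 0`. Equivalently
`T̂ ∈ span{e₃, e₄}` — so the twist `[ℋ, ℋ]^⊥ ⊂ span{e₃, e₄} ∩ ker dr = ℝ T̂` is carried by a field
in the `C^∞(r)`-span of the Killing fields. -/
theorem hawkingFieldVertical (M a : ℝ) (x : E4) (hr : 0 < Kerr.radius a x) (v : E4)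
    (hℓ : Kerr.nullCovector a x v = 0) (hν : radialCovector a x v = 0) :
    Kerr.bilin M a x (hawkingVector a x) v = 0 := by
  rw [Kerr.bilin_apply, hawkingCovectorIdentity a x hr v, hℓ, hν]
  ring

/-- **F2. `ν` is a positive multiple of `dr`** wherever `r > 0` (so `ker ν = ker dr` and
`ℋ = ker ℓ ∩ ker ν`). Stated, not proved (implicit-function calculus on `Kerr.radius`; verified
numerically by finite differences, folder `verify_twist_num.py`). -/
def RadialCovectorIsDifferential : Prop :=
  ∀ (a : ℝ) (x : E4), 0 < Kerr.radius a x →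
    HasFDerivAt (Kerr.radius a)
      ((Kerr.radius a x / (Kerr.radius a x ^ 4 + a ^ 2 * x 3 ^ 2)) • radialCovector a x) x

/-- **F3. Killing span (definitional).** On every Kerr chart domain the Hawking field is the
`C^∞(r)`-combination `∂_{t*} + (a/(r² + a²)) ∂_φ` of the two vendored Killing fields. -/
theorem hawkingVector_eq_killing_combination (a r₀ : ℝ) (x : Kerr.region a r₀) :
    hawkingVector a x.1 =
      (Kerr.stationaryField a r₀ x : E4) +
        (a / (Kerr.radius a x.1 ^ 2 + a ^ 2)) • (Kerr.axialField a r₀ x : E4) :=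
  rfl

/-- **F4. The Hawking field is timelike on the open exterior** `r > r₊` (and null on `r = r₊`):
`g(T̂, T̂) = −Δ |q|² / (r² + a²)²`, `Δ = r² − 2Mr + a²`, `|q|² = r² + a² x₃²/r²` — GKS Prop. 3.2.2,
here in Kerr–Schild Cartesian form; stated, not proved (uses the quartic; verified numerically). -/
def HawkingFieldTimelike : Prop :=
  ∀ (M a : ℝ) (x : E4), Kerr.IsSubextremal M a → Kerr.rPlus M a < Kerr.radius a x →
    Kerr.bilin M a x (hawkingVector a x) (hawkingVector a x) < 0

/-! **Shape of the line's last step (landed, for reference):** the crux is equivalent to the family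
of locally-uniform `k = 2` capture germs at every normalised centre `|χ₀| < 1`
(`Summit.FinalStateConjecture.FinalStateConjecture.Theorems.BulkKerrCaptureC2.NormalForm.stub_bulkKerrCaptureC2_iff_unitLeafGermTwo`,
file `Theorems/PhaseMixingCaptureBulkKerrCaptureC2NormalForm.lean`, p106217); the vector-field line
supplies the germs centre by centre and the port is that `Iff`'s `.2`. The crux decl is in scope: -/
example : Prop :=
  Summit.FinalStateConjecture.FinalStateConjecture.Theses.PhaseMixingCapture.BulkKerrCaptureC2

end Summit.FinalStateConjecture.FinalStateConjecture.Cruxes.BulkKerrCaptureC2.Ideator4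

end
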